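import Mathlib
import HarnessLib
import Summits.Ventures.LatticeQCDFlow.Exactness.SUNWilsonHMCErgodic
import Summits.Ventures.LatticeQCDFlow.Exactness.DoeblinObservables
import Summits.Ventures.LatticeQCDFlow.Exactness.OpenBoundaryHMCForce
import Summits.Ventures.LatticeQCDFlow.Exactness.WeightedOverrelaxation
import Summits.Ventures.LatticeQCDFlow.Exactness.OpenBoundaryTranslation

/-!
# The two periodic arms of row 21 agree: the engine's HMC run and the heat-bath + overrelaxation run give every bounded observable the same limiting expectation — the Wilson one — with explicit geometric rates

HONEST FRAMING: exact (Metropolis-corrected) sampling algorithms for lattice gauge theory;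
figures of merit are autocorrelation/cost numbers at stated couplings and volumes; no
continuum-physics claim.

Venture `LatticeQCDFlow` (cell pub-lqcd), topic `Exactness`, FANOUT row 21 (`su3-base`: acceptance (a) is the CROSS-IMPLEMENTATION
check "plaquette of arm E1 = 1HB+n·OR and of arm E2 = PBC-HMC agree within 3σ and with the literature value").  NEW WORK of the
cell: the exact counterpart of that check, assembled from row 21's `SUNWilsonHMCErgodic` (`wilsonForce_sunLeapfrogHMCN_uniformlyErgodic`:
the engine's `n`-step leapfrog HMC with its own Wilson force converges setwise to the Wilson measure, geometrically, from every
start, below a volume-uniform trajectory threshold), row 9's `CabibboMarinariORSweep` (`wilson_cmHeatBath_orSweep_uniformlyErgodic`: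
the `'hb' + n_or × 'or'` composite converges setwise, geometrically, from every start) and row 9's `DoeblinObservables`
(`abs_integral_sub_integral_le_of_setwise`: setwise bounds control every `[0,1]`-valued observable).  Def-free; nothing is
cited as a fact; no number.

* §1 (row 9's `isProbabilityMeasure_iterate_bind`: iterating a Markov kernel from a probability start gives probability laws;
  the HMC arms' kernels are Markov (inline, as in row 21's `EngineHMCReversible`); `isMarkovKernel_cmHeatBath_orSweep`: the
  E1 composite is Markov.)
* §2 **`wilsonHmcRun_integral_sub_wilson_le`** — for the HMC arm (every `L`, `n ≥ 1`, `ε > 0` with `nε ≤ τ₀(N,d,β)`): there are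
  `k`, `δ ∈ (0,1]` with `|E_t[g] − ⟨g⟩_W| ≤ (1 − δ)^{⌊t/(k+1)⌋}` for EVERY probability start, every `t`, every measurable `g` with
  `0 ≤ g ≤ 1`; **`e1Run_integral_sub_wilson_le`** — for the E1 arm (`L ≥ 2`, lexicographic or reversed subgroup order, every
  link visited, any OR schedule): `ε > 0` with `|E_t[g] − ⟨g⟩_W| ≤ (1 − ε)^t` likewise.
* §3 **`twoArms_integral_sub_le`** — hence the two runs' expectations of every such `g` differ by at most
  `(1 − δ)^{⌊t/(k+1)⌋} + (1 − ε)^{t'}` at steps `t`, `t'`, whatever the two starts; **`tendsto_twoArms_integral_sub`** — the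
  difference tends to `0`, and both tend to `⟨g⟩_W` (`tendsto_wilsonHmcRun_integral`, `tendsto_e1Run_integral`).
* §4 THE SAME WITH OPEN BOUNDARIES (row 21's `OpenBoundaryHMCForce.obcForce_sunLeapfrogHMCN_uniformlyErgodic` and
  `WeightedOverrelaxation.obc_cmHeatBath_orSweep_uniformlyErgodic`): `gibbsProbability_pi_eq_piGibbsLaw` (the two spellings of the
  open-boundary Gibbs law agree), `obcHmcRun_integral_sub_le`, `obcE1Run_integral_sub_le`, **`twoArmsOBC_integral_sub_le`**.
* §5 THE PLAQUETTE OF RECORD: **`twoArms_plaqRe_sub_le`** — for every plaquette `p`,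
  `|E^{HMC}_t[Re tr U_p] − E^{E1}_{t'}[Re tr U_p]| ≤ 2N((1 − δ)^{⌊t/(k+1)⌋} + (1 − ε')^{t'})` (affine rescaling of the `[0,1]`-valued
  `(1 + Re tr U_p/N)/2`, the Literature's `abs_plaqRe_le`).
Reading: a persistent disagreement of the two arms on a bounded observable (e.g. `(1 + Re tr U_p/N)/2`) beyond errors indicts an
implementation, never the algorithms.  NOT CLAIMED: the values of `k`, `δ`, `ε` (they depend on everything, incl. `L`); error bars
at finite statistics (the scorers'); numbers.
-/

noncomputable section

namespace Summit.Ventures.LatticeQCDFlow.Exactness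

open MeasureTheory ProbabilityTheory ProbabilityTheory.Kernel Set Function Filter Topology
open Literature.MathematicalPhysics.QuantumFieldTheory
open scoped ENNReal Matrix

set_option backward.isDefEq.respectTransparency false

/-! ## §2 Each arm: every `[0,1]`-valued observable converges to its Wilson expectation, geometrically -/

section Arms

variable (N : ℕ) [NeZero N] (d : ℕ) (β : ℝ)

/-- **HMC ARM: `|E_t[g] − ⟨g⟩_W| ≤ (1 − δ)^{⌊t/(k+1)⌋}`** for every probability start, every `t` and every measurable `g` with
`0 ≤ g ≤ 1`, below the volume-uniform trajectory threshold. -/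
theorem wilsonHmcRun_integral_sub_wilson_le (L : ℕ) [NeZero L] {nstep : ℕ} {ε : ℝ} (hn : 1 ≤ nstep) (hε : 0 < ε)
    (hτ : nstep * ε ≤ sunWilsonTrajThreshold N d β) :
    ∃ k : ℕ, ∃ δ : ℝ, 0 < δ ∧ δ ≤ 1 ∧
      ∀ (μ₀ : Measure (GaugeConfig d L (Matrix.specialUnitaryGroup (Fin N) ℂ))) [IsProbabilityMeasure μ₀] (t : ℕ)
        {g : GaugeConfig d L (Matrix.specialUnitaryGroup (Fin N) ℂ) → ℝ}, Measurable g → (∀ U, 0 ≤ g U) → (∀ U, g U ≤ 1) →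
        |∫ U, g U ∂((fun m : Measure (GaugeConfig d L (Matrix.specialUnitaryGroup (Fin N) ℂ)) =>
              m.bind (sunLeapfrogHMCN (sunCoordι N) (sunCoordι_skew N) ε (Measure.addHaar : Measure (SUNCoords N))
                (sunKinetic N) (measurable_halfKick_sun N (measurable_sunWilsonForce N (d := d) (L := L) β) ε)
                (fun U => β * wilsonAction (suRep N) U) nstep))^[t] μ₀)
            - ∫ U, g U ∂(wilsonMeasure (d := d) (L := L) (suRep N) β)| ≤ (1 - δ) ^ (t / (k + 1)) := by
  obtain ⟨k, δ, hδ, hδ1, h⟩ := wilsonForce_sunLeapfrogHMCN_uniformlyErgodic N d β L hn hε hτ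
  refine ⟨k, δ, hδ, hδ1, fun μ₀ _ t g hg h0 h1 => ?_⟩
  haveI : IsMarkovKernel (sunLeapfrogHMCN (sunCoordι N) (sunCoordι_skew N) ε (Measure.addHaar : Measure (SUNCoords N))
      (sunKinetic N) (measurable_halfKick_sun N (measurable_sunWilsonForce N (d := d) (L := L) β) ε)
      (fun U => β * wilsonAction (suRep N) U) nstep) := by
    haveI : Fact (Measurable fun z : GaugeConfig d L (Matrix.specialUnitaryGroup (Fin N) ℂ) × (Edge d L → SUNCoords N) =>
        β * wilsonAction (suRep N) z.1 + sunKinetic N z.2) :=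
      ⟨((continuous_smul_wilsonAction (suRep N) continuous_suRep β).measurable.comp measurable_fst).add
        ((measurable_sunKinetic N).comp measurable_snd)⟩
    haveI := isProbabilityMeasure_sunMomentumLaw (L := Edge d L) (Measure.addHaar : Measure (SUNCoords N)) (sunKinetic N)
      (measurable_sunKinetic N) (sunMomentumWeight_sunKinetic_ne_top N Measure.addHaar)
    unfold sunLeapfrogHMCN; infer_instance
  haveI := isProbabilityMeasure_iterate_bind (κ := sunLeapfrogHMCN (sunCoordι N) (sunCoordι_skew N) ε
    (Measure.addHaar : Measure (SUNCoords N)) (sunKinetic N)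
    (measurable_halfKick_sun N (measurable_sunWilsonForce N (d := d) (L := L) β) ε) (fun U => β * wilsonAction (suRep N) U) nstep) μ₀ t
  haveI := isProbabilityMeasure_wilsonMeasure (d := d) (L := L) (suRep N) continuous_suRep β
  exact abs_integral_sub_integral_le_of_setwise (fun A _ => h μ₀ t A) hg h0 h1

variable {m : Type*} [Fintype m] [DecidableEq m]

omit [NeZero N] in
/-- The E1 composite kernel (CM heat-bath sweep for the Wilson weight, then an OR schedule) is Markov. -/
theorem isMarkovKernel_cmHeatBath_orSweep (L : ℕ) [NeZero L] (frames : List (Fin N ≃ Fin 2 ⊕ m)) (links : List (Edge d L))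
    (sched : List (Edge d L × (Fin N ≃ Fin 2 ⊕ m))) :
    IsMarkovKernel (cmORSweep sched ∘ₖ latSweep (gibbsDensity fun U : GaugeConfig d L (Matrix.specialUnitaryGroup (Fin N) ℂ) =>
      β * wilsonAction (suRep N) U) frames links) := by
  have hS : Continuous fun U : GaugeConfig d L (Matrix.specialUnitaryGroup (Fin N) ℂ) =>
      β * wilsonAction (suRep N) U := continuous_smul_wilsonAction (suRep N) continuous_suRep β
  obtain ⟨ωa, -, hmin⟩ := isCompact_univ.exists_isMinOn
    (Set.univ_nonempty (α := GaugeConfig d L (Matrix.specialUnitaryGroup (Fin N) ℂ))) hS.continuousOn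
  obtain ⟨ωb, -, hmax⟩ := isCompact_univ.exists_isMaxOn
    (Set.univ_nonempty (α := GaugeConfig d L (Matrix.specialUnitaryGroup (Fin N) ℂ))) hS.continuousOn
  have hωa : ∀ ω, β * wilsonAction (suRep N) ωa ≤ β * wilsonAction (suRep N) ω := fun ω =>
    (isMinOn_iff.1 hmin) ω (Set.mem_univ ω)
  have hωb : ∀ ω, β * wilsonAction (suRep N) ω ≤ β * wilsonAction (suRep N) ωb := fun ω =>
    (isMaxOn_iff.1 hmax) ω (Set.mem_univ ω)
  have hm0 : ENNReal.ofReal (Real.exp (-(β * wilsonAction (suRep N) ωb))) ≠ 0 := by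
    rw [Ne, ENNReal.ofReal_eq_zero, not_le]; exact Real.exp_pos _
  haveI := isMarkovKernel_latSweep (measurable_gibbsDensity hS) hm0 ENNReal.ofReal_ne_top
    (fun ω => (gibbsDensity_bounds hωa hωb ω).1) (fun ω => (gibbsDensity_bounds hωa hωb ω).2) frames links
  infer_instance

/-- **E1 ARM: `|E_t[g] − ⟨g⟩_W| ≤ (1 − ε)^t`** for every probability start, every `t` and every measurable `g` with `0 ≤ g ≤ 1`
(`L ≥ 2`; one Cabibbo–Marinari heat-bath sweep in lexicographic or reversed subgroup order visiting every link, then any OR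
schedule). -/
theorem e1Run_integral_sub_wilson_le (L : ℕ) [NeZero L] (hL : 2 ≤ L) (frames : List (Fin N ≃ Fin 2 ⊕ m))
    (hlex : frames.map pairOf = lexPairs (Finset.univ.sort (· ≤ ·) : List (Fin N)) ∨
      frames.map pairOf = (lexPairs (Finset.univ.sort (· ≤ ·) : List (Fin N))).reverse)
    {links : List (Edge d L)} (hl : ∀ l, l ∈ links) (sched : List (Edge d L × (Fin N ≃ Fin 2 ⊕ m))) :
    ∃ ε : ℝ, 0 < ε ∧ ∀ (μ₀ : Measure (GaugeConfig d L (Matrix.specialUnitaryGroup (Fin N) ℂ))) [IsProbabilityMeasure μ₀]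
      (t : ℕ) {g : GaugeConfig d L (Matrix.specialUnitaryGroup (Fin N) ℂ) → ℝ}, Measurable g → (∀ U, 0 ≤ g U) → (∀ U, g U ≤ 1) →
      |∫ U, g U ∂((fun ν : Measure (GaugeConfig d L (Matrix.specialUnitaryGroup (Fin N) ℂ)) =>
            ν.bind (cmORSweep sched ∘ₖ latSweep (gibbsDensity fun U => β * wilsonAction (suRep N) U) frames links))^[t] μ₀)
          - ∫ U, g U ∂(wilsonMeasure (suRep N) β)| ≤ (1 - ε) ^ t := by
  obtain ⟨ε, hε, h⟩ := wilson_cmHeatBath_orSweep_uniformlyErgodic (d := d) (N := N) β hL frames hlex hl sched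
  refine ⟨ε, hε, fun μ₀ _ t g hg h0 h1 => ?_⟩
  haveI := isMarkovKernel_cmHeatBath_orSweep N d β L frames links sched
  haveI := isProbabilityMeasure_iterate_bind
    (κ := cmORSweep sched ∘ₖ latSweep (gibbsDensity fun U => β * wilsonAction (suRep N) U) frames links) μ₀ t
  haveI := isProbabilityMeasure_wilsonMeasure (d := d) (L := L) (suRep N) continuous_suRep β
  exact abs_integral_sub_integral_le_of_setwise (fun A _ => h μ₀ t A) hg h0 h1

/-! ## §3 The two arms agree -/

/-- **THE TWO PERIODIC ARMS AGREE ON EVERY BOUNDED OBSERVABLE, WITH RATES**: under the hypotheses of §2 there are `k`, `δ ∈ (0,1]`,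
`ε' > 0` such that for all probability starts `μ₀`, `μ₀'`, all steps `t`, `t'` and every measurable `g` with `0 ≤ g ≤ 1`,
`|E^{HMC}_t[g] − E^{E1}_{t'}[g]| ≤ (1 − δ)^{⌊t/(k+1)⌋} + (1 − ε')^{t'}`. -/
theorem twoArms_integral_sub_le (L : ℕ) [NeZero L] (hL : 2 ≤ L) {nstep : ℕ} {ε : ℝ} (hn : 1 ≤ nstep) (hε : 0 < ε)
    (hτ : nstep * ε ≤ sunWilsonTrajThreshold N d β) (frames : List (Fin N ≃ Fin 2 ⊕ m))
    (hlex : frames.map pairOf = lexPairs (Finset.univ.sort (· ≤ ·) : List (Fin N)) ∨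
      frames.map pairOf = (lexPairs (Finset.univ.sort (· ≤ ·) : List (Fin N))).reverse)
    {links : List (Edge d L)} (hl : ∀ l, l ∈ links) (sched : List (Edge d L × (Fin N ≃ Fin 2 ⊕ m))) :
    ∃ k : ℕ, ∃ δ : ℝ, ∃ ε' : ℝ, 0 < δ ∧ δ ≤ 1 ∧ 0 < ε' ∧
      ∀ (μ₀ μ₀' : Measure (GaugeConfig d L (Matrix.specialUnitaryGroup (Fin N) ℂ))) [IsProbabilityMeasure μ₀]
        [IsProbabilityMeasure μ₀'] (t t' : ℕ) {g : GaugeConfig d L (Matrix.specialUnitaryGroup (Fin N) ℂ) → ℝ},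
        Measurable g → (∀ U, 0 ≤ g U) → (∀ U, g U ≤ 1) →
        |∫ U, g U ∂((fun ν : Measure (GaugeConfig d L (Matrix.specialUnitaryGroup (Fin N) ℂ)) =>
              ν.bind (sunLeapfrogHMCN (sunCoordι N) (sunCoordι_skew N) ε (Measure.addHaar : Measure (SUNCoords N))
                (sunKinetic N) (measurable_halfKick_sun N (measurable_sunWilsonForce N (d := d) (L := L) β) ε)
                (fun U => β * wilsonAction (suRep N) U) nstep))^[t] μ₀)
          - ∫ U, g U ∂((fun ν : Measure (GaugeConfig d L (Matrix.specialUnitaryGroup (Fin N) ℂ)) =>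
              ν.bind (cmORSweep sched ∘ₖ latSweep (gibbsDensity fun U => β * wilsonAction (suRep N) U) frames links))^[t'] μ₀')|
          ≤ (1 - δ) ^ (t / (k + 1)) + (1 - ε') ^ t' := by
  obtain ⟨k, δ, hδ, hδ1, hH⟩ := wilsonHmcRun_integral_sub_wilson_le N d β L hn hε hτ
  obtain ⟨ε', hε', hE⟩ := e1Run_integral_sub_wilson_le N d β L hL frames hlex hl sched
  refine ⟨k, δ, ε', hδ, hδ1, hε', fun μ₀ μ₀' _ _ t t' g hg h0 h1 => ?_⟩
  have h1' := hH μ₀ t hg h0 h1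
  have h2' := hE μ₀' t' hg h0 h1
  rw [abs_sub_comm] at h2'
  exact (abs_sub_le _ _ _).trans (add_le_add h1' h2')

/-- **HMC arm: `E_t[g] → ⟨g⟩_W`** for every probability start and every measurable `0 ≤ g ≤ 1`. -/
theorem tendsto_wilsonHmcRun_integral (L : ℕ) [NeZero L] {nstep : ℕ} {ε : ℝ} (hn : 1 ≤ nstep) (hε : 0 < ε)
    (hτ : nstep * ε ≤ sunWilsonTrajThreshold N d β) (μ₀ : Measure (GaugeConfig d L (Matrix.specialUnitaryGroup (Fin N) ℂ)))
    [IsProbabilityMeasure μ₀] {g : GaugeConfig d L (Matrix.specialUnitaryGroup (Fin N) ℂ) → ℝ} (hg : Measurable g)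
    (h0 : ∀ U, 0 ≤ g U) (h1 : ∀ U, g U ≤ 1) :
    Tendsto (fun t : ℕ => ∫ U, g U ∂((fun ν : Measure (GaugeConfig d L (Matrix.specialUnitaryGroup (Fin N) ℂ)) =>
        ν.bind (sunLeapfrogHMCN (sunCoordι N) (sunCoordι_skew N) ε (Measure.addHaar : Measure (SUNCoords N))
          (sunKinetic N) (measurable_halfKick_sun N (measurable_sunWilsonForce N (d := d) (L := L) β) ε)
          (fun U => β * wilsonAction (suRep N) U) nstep))^[t] μ₀)) atTop
      (𝓝 (∫ U, g U ∂(wilsonMeasure (d := d) (L := L) (suRep N) β))) := by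
  obtain ⟨k, δ, hδ, hδ1, h⟩ := wilsonHmcRun_integral_sub_wilson_le N d β L hn hε hτ
  rw [tendsto_iff_norm_sub_tendsto_zero]
  have hgeo : Tendsto (fun t : ℕ => (1 - δ) ^ (t / (k + 1))) atTop (𝓝 0) := by
    have hq : Tendsto (fun t : ℕ => t / (k + 1)) atTop atTop :=
      Filter.tendsto_atTop_atTop.2 fun b => ⟨b * (k + 1), fun t ht => (Nat.le_div_iff_mul_le (Nat.succ_pos k)).2 ht⟩
    exact (tendsto_pow_atTop_nhds_zero_of_lt_one (by linarith) (by linarith)).comp hq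
  exact squeeze_zero (fun t => norm_nonneg _) (fun t => by rw [Real.norm_eq_abs]; exact h μ₀ t hg h0 h1) hgeo

/-- **E1 arm: `E_t[g] → ⟨g⟩_W`** for every probability start and every measurable `0 ≤ g ≤ 1`. -/
theorem tendsto_e1Run_integral (L : ℕ) [NeZero L] (hL : 2 ≤ L) (frames : List (Fin N ≃ Fin 2 ⊕ m))
    (hlex : frames.map pairOf = lexPairs (Finset.univ.sort (· ≤ ·) : List (Fin N)) ∨
      frames.map pairOf = (lexPairs (Finset.univ.sort (· ≤ ·) : List (Fin N))).reverse)
    {links : List (Edge d L)} (hl : ∀ l, l ∈ links) (sched : List (Edge d L × (Fin N ≃ Fin 2 ⊕ m)))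
    (μ₀ : Measure (GaugeConfig d L (Matrix.specialUnitaryGroup (Fin N) ℂ))) [IsProbabilityMeasure μ₀]
    {g : GaugeConfig d L (Matrix.specialUnitaryGroup (Fin N) ℂ) → ℝ} (hg : Measurable g) (h0 : ∀ U, 0 ≤ g U) (h1 : ∀ U, g U ≤ 1) :
    Tendsto (fun t : ℕ => ∫ U, g U ∂((fun ν : Measure (GaugeConfig d L (Matrix.specialUnitaryGroup (Fin N) ℂ)) =>
        ν.bind (cmORSweep sched ∘ₖ latSweep (gibbsDensity fun U => β * wilsonAction (suRep N) U) frames links))^[t] μ₀)) atTop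
      (𝓝 (∫ U, g U ∂(wilsonMeasure (suRep N) β))) := by
  obtain ⟨ε, hε, h⟩ := e1Run_integral_sub_wilson_le N d β L hL frames hlex hl sched
  have hε1 : ε ≤ 1 := by
    by_contra hc
    have h00 := h μ₀ 1 (g := fun _ => 0) measurable_const (fun _ => le_rfl) (fun _ => zero_le_one)
    have : (1 - ε) ^ 1 < 0 := by rw [pow_one]; linarith
    exact absurd (h00.trans_lt this) (not_lt.2 (abs_nonneg _))
  rw [tendsto_iff_norm_sub_tendsto_zero]
  exact squeeze_zero (fun t => norm_nonneg _) (fun t => by rw [Real.norm_eq_abs]; exact h μ₀ t hg h0 h1)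
    (tendsto_pow_atTop_nhds_zero_of_lt_one (by linarith) (by linarith))

/-! ## §4 The same with open boundaries -/

omit [NeZero N] in
/-- The two spellings of a Gibbs law over product Haar agree: `gibbsProbability (⊗Haar) e^{−S} = piGibbsLaw Haar (gibbsDensity S)`. -/
theorem gibbsProbability_pi_eq_piGibbsLaw (L : ℕ) [NeZero L] (S : GaugeConfig d L (Matrix.specialUnitaryGroup (Fin N) ℂ) → ℝ) :
    gibbsProbability (Measure.pi fun _ : Edge d L => haarProbability (Matrix.specialUnitaryGroup (Fin N) ℂ))
        (fun U => Real.exp (-(S U))) =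
      piGibbsLaw (linkHaar (Edge d L) (Fin N)) (gibbsDensity S) := by
  unfold gibbsProbability piGibbsLaw gibbsDensity linkHaar
  rw [withDensity_apply _ MeasurableSet.univ, Measure.restrict_univ]

/-- **OBC HMC ARM: `|E_t[g] − ⟨g⟩_OBC| ≤ (1 − δ)^{⌊t/(k+1)⌋}`** for every probability start, `t`, measurable `0 ≤ g ≤ 1`, below the same
volume-uniform trajectory threshold (every open direction `τ`). -/
theorem obcHmcRun_integral_sub_le (τ : Fin d) (L : ℕ) [NeZero L] {nstep : ℕ} {ε : ℝ} (hn : 1 ≤ nstep) (hε : 0 < ε)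
    (hτ : nstep * ε ≤ sunWilsonTrajThreshold N d β) :
    ∃ k : ℕ, ∃ δ : ℝ, 0 < δ ∧ δ ≤ 1 ∧
      ∀ (μ₀ : Measure (GaugeConfig d L (Matrix.specialUnitaryGroup (Fin N) ℂ))) [IsProbabilityMeasure μ₀] (t : ℕ)
        {g : GaugeConfig d L (Matrix.specialUnitaryGroup (Fin N) ℂ) → ℝ}, Measurable g → (∀ U, 0 ≤ g U) → (∀ U, g U ≤ 1) →
        |∫ U, g U ∂((fun m : Measure (GaugeConfig d L (Matrix.specialUnitaryGroup (Fin N) ℂ)) =>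
              m.bind (sunLeapfrogHMCN (sunCoordι N) (sunCoordι_skew N) ε (Measure.addHaar : Measure (SUNCoords N))
                (sunKinetic N) (measurable_halfKick_sun N (measurable_sunWeightedForce N (d := d) (L := L) (obcWeight τ) β) ε)
                (fun U => β * obcAction (suRep N) τ U) nstep))^[t] μ₀)
            - ∫ U, g U ∂(gibbsProbability (Measure.pi fun _ : Edge d L => haarProbability (Matrix.specialUnitaryGroup (Fin N) ℂ))
                (fun U => Real.exp (-(β * obcAction (suRep N) τ U))))| ≤ (1 - δ) ^ (t / (k + 1)) := by
  obtain ⟨k, δ, hδ, hδ1, h⟩ := obcForce_sunLeapfrogHMCN_uniformlyErgodic N d β τ L hn hε hτ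
  refine ⟨k, δ, hδ, hδ1, fun μ₀ _ t g hg h0 h1 => ?_⟩
  haveI : IsMarkovKernel (sunLeapfrogHMCN (sunCoordι N) (sunCoordι_skew N) ε (Measure.addHaar : Measure (SUNCoords N))
      (sunKinetic N) (measurable_halfKick_sun N (measurable_sunWeightedForce N (d := d) (L := L) (obcWeight τ) β) ε)
      (fun U => β * obcAction (suRep N) τ U) nstep) := by
    haveI : Fact (Measurable fun z : GaugeConfig d L (Matrix.specialUnitaryGroup (Fin N) ℂ) × (Edge d L → SUNCoords N) =>
        β * obcAction (suRep N) τ z.1 + sunKinetic N z.2) :=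
      ⟨(((continuous_obcAction (suRep N) continuous_suRep τ).measurable.const_mul β).comp measurable_fst).add
        ((measurable_sunKinetic N).comp measurable_snd)⟩
    haveI := isProbabilityMeasure_sunMomentumLaw (L := Edge d L) (Measure.addHaar : Measure (SUNCoords N)) (sunKinetic N)
      (measurable_sunKinetic N) (sunMomentumWeight_sunKinetic_ne_top N Measure.addHaar)
    unfold sunLeapfrogHMCN; infer_instance
  haveI := isProbabilityMeasure_iterate_bind (κ := sunLeapfrogHMCN (sunCoordι N) (sunCoordι_skew N) ε
    (Measure.addHaar : Measure (SUNCoords N)) (sunKinetic N)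
    (measurable_halfKick_sun N (measurable_sunWeightedForce N (d := d) (L := L) (obcWeight τ) β) ε)
    (fun U => β * obcAction (suRep N) τ U) nstep) μ₀ t
  haveI := isProbabilityMeasure_obcGibbs (d := d) (L := L) (suRep N) continuous_suRep τ β
  exact abs_integral_sub_integral_le_of_setwise (fun A _ => h μ₀ t A) hg h0 h1

/-- **OBC E1 ARM: `|E_t[g] − ⟨g⟩_OBC| ≤ (1 − ε)^t`** (CM heat bath for `e^{−βS_OBC}` then any open-boundary-weighted OR schedule;
`L ≥ 2`). -/
theorem obcE1Run_integral_sub_le (τ : Fin d) (L : ℕ) [NeZero L] (hL : 2 ≤ L) (frames : List (Fin N ≃ Fin 2 ⊕ m))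
    (hlex : frames.map pairOf = lexPairs (Finset.univ.sort (· ≤ ·) : List (Fin N)) ∨
      frames.map pairOf = (lexPairs (Finset.univ.sort (· ≤ ·) : List (Fin N))).reverse)
    {links : List (Edge d L)} (hl : ∀ l, l ∈ links) (sched : List (Edge d L × (Fin N ≃ Fin 2 ⊕ m))) :
    ∃ ε : ℝ, 0 < ε ∧ ∀ (μ₀ : Measure (GaugeConfig d L (Matrix.specialUnitaryGroup (Fin N) ℂ))) [IsProbabilityMeasure μ₀]
      (t : ℕ) {g : GaugeConfig d L (Matrix.specialUnitaryGroup (Fin N) ℂ) → ℝ}, Measurable g → (∀ U, 0 ≤ g U) → (∀ U, g U ≤ 1) →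
      |∫ U, g U ∂((fun ν : Measure (GaugeConfig d L (Matrix.specialUnitaryGroup (Fin N) ℂ)) =>
            ν.bind (cmORSweepW (obcWeight τ) sched ∘ₖ latSweep (gibbsDensity fun U => β * obcAction (suRep N) τ U) frames links))^[t] μ₀)
          - ∫ U, g U ∂(gibbsProbability (Measure.pi fun _ : Edge d L => haarProbability (Matrix.specialUnitaryGroup (Fin N) ℂ))
              (fun U => Real.exp (-(β * obcAction (suRep N) τ U))))| ≤ (1 - ε) ^ t := by
  obtain ⟨ε, hε, h⟩ := obc_cmHeatBath_orSweep_uniformlyErgodic (d := d) (N := N) β hL τ frames hlex hl sched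
  refine ⟨ε, hε, fun μ₀ _ t g hg h0 h1 => ?_⟩
  have hS : Continuous fun U : GaugeConfig d L (Matrix.specialUnitaryGroup (Fin N) ℂ) => β * obcAction (suRep N) τ U :=
    (continuous_obcAction (suRep N) continuous_suRep τ).const_smul β
  obtain ⟨ωa, -, hmin⟩ := isCompact_univ.exists_isMinOn
    (Set.univ_nonempty (α := GaugeConfig d L (Matrix.specialUnitaryGroup (Fin N) ℂ))) hS.continuousOn
  obtain ⟨ωb, -, hmax⟩ := isCompact_univ.exists_isMaxOn
    (Set.univ_nonempty (α := GaugeConfig d L (Matrix.specialUnitaryGroup (Fin N) ℂ))) hS.continuousOn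
  have hωa : ∀ ω, β * obcAction (suRep N) τ ωa ≤ β * obcAction (suRep N) τ ω := fun ω => (isMinOn_iff.1 hmin) ω (Set.mem_univ ω)
  have hωb : ∀ ω, β * obcAction (suRep N) τ ω ≤ β * obcAction (suRep N) τ ωb := fun ω => (isMaxOn_iff.1 hmax) ω (Set.mem_univ ω)
  have hm0 : ENNReal.ofReal (Real.exp (-(β * obcAction (suRep N) τ ωb))) ≠ 0 := by
    rw [Ne, ENNReal.ofReal_eq_zero, not_le]; exact Real.exp_pos _
  haveI := isMarkovKernel_latSweep (measurable_gibbsDensity hS) hm0 ENNReal.ofReal_ne_top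
    (fun ω => (gibbsDensity_bounds hωa hωb ω).1) (fun ω => (gibbsDensity_bounds hωa hωb ω).2) frames links
  haveI := isProbabilityMeasure_iterate_bind
    (κ := cmORSweepW (obcWeight τ) sched ∘ₖ latSweep (gibbsDensity fun U => β * obcAction (suRep N) τ U) frames links) μ₀ t
  haveI := isProbabilityMeasure_obcGibbs (d := d) (L := L) (suRep N) continuous_suRep τ β
  rw [gibbsProbability_pi_eq_piGibbsLaw]
  rw [gibbsProbability_pi_eq_piGibbsLaw] at *
  exact abs_integral_sub_integral_le_of_setwise (fun A _ => h μ₀ t A) hg h0 h1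

/-- **THE TWO OPEN-BOUNDARY ARMS AGREE ON EVERY BOUNDED OBSERVABLE, WITH RATES.** -/
theorem twoArmsOBC_integral_sub_le (τ : Fin d) (L : ℕ) [NeZero L] (hL : 2 ≤ L) {nstep : ℕ} {ε : ℝ} (hn : 1 ≤ nstep)
    (hε : 0 < ε) (hτ : nstep * ε ≤ sunWilsonTrajThreshold N d β) (frames : List (Fin N ≃ Fin 2 ⊕ m))
    (hlex : frames.map pairOf = lexPairs (Finset.univ.sort (· ≤ ·) : List (Fin N)) ∨
      frames.map pairOf = (lexPairs (Finset.univ.sort (· ≤ ·) : List (Fin N))).reverse)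
    {links : List (Edge d L)} (hl : ∀ l, l ∈ links) (sched : List (Edge d L × (Fin N ≃ Fin 2 ⊕ m))) :
    ∃ k : ℕ, ∃ δ : ℝ, ∃ ε' : ℝ, 0 < δ ∧ δ ≤ 1 ∧ 0 < ε' ∧
      ∀ (μ₀ μ₀' : Measure (GaugeConfig d L (Matrix.specialUnitaryGroup (Fin N) ℂ))) [IsProbabilityMeasure μ₀]
        [IsProbabilityMeasure μ₀'] (t t' : ℕ) {g : GaugeConfig d L (Matrix.specialUnitaryGroup (Fin N) ℂ) → ℝ},
        Measurable g → (∀ U, 0 ≤ g U) → (∀ U, g U ≤ 1) →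
        |∫ U, g U ∂((fun ν : Measure (GaugeConfig d L (Matrix.specialUnitaryGroup (Fin N) ℂ)) =>
              ν.bind (sunLeapfrogHMCN (sunCoordι N) (sunCoordι_skew N) ε (Measure.addHaar : Measure (SUNCoords N))
                (sunKinetic N) (measurable_halfKick_sun N (measurable_sunWeightedForce N (d := d) (L := L) (obcWeight τ) β) ε)
                (fun U => β * obcAction (suRep N) τ U) nstep))^[t] μ₀)
          - ∫ U, g U ∂((fun ν : Measure (GaugeConfig d L (Matrix.specialUnitaryGroup (Fin N) ℂ)) =>
              ν.bind (cmORSweepW (obcWeight τ) sched ∘ₖ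
                latSweep (gibbsDensity fun U => β * obcAction (suRep N) τ U) frames links))^[t'] μ₀')|
          ≤ (1 - δ) ^ (t / (k + 1)) + (1 - ε') ^ t' := by
  obtain ⟨k, δ, hδ, hδ1, hH⟩ := obcHmcRun_integral_sub_le N d β τ L hn hε hτ
  obtain ⟨ε', hε', hE⟩ := obcE1Run_integral_sub_le N d β τ L hL frames hlex hl sched
  refine ⟨k, δ, ε', hδ, hδ1, hε', fun μ₀ μ₀' _ _ t t' g hg h0 h1 => ?_⟩
  have h1' := hH μ₀ t hg h0 h1
  have h2' := hE μ₀' t' hg h0 h1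
  rw [abs_sub_comm] at h2'
  exact (abs_sub_le _ _ _).trans (add_le_add h1' h2')

/-! ## §5 The plaquette of record -/

omit [NeZero N] in
/-- Affine rescaling of a difference of expectations of the normalised plaquette. -/
theorem integral_plaqRe_sub_eq [NeZero N] {L : ℕ} (μ ν : Measure (GaugeConfig d L (Matrix.specialUnitaryGroup (Fin N) ℂ)))
    [IsProbabilityMeasure μ] [IsProbabilityMeasure ν] (p : Plaquette d L) :
    ∫ U, WilsonRP.plaqRe (suRep N) U p ∂μ - ∫ U, WilsonRP.plaqRe (suRep N) U p ∂ν =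
      2 * N * (∫ U, (1 + WilsonRP.plaqRe (suRep N) U p / N) / 2 ∂μ - ∫ U, (1 + WilsonRP.plaqRe (suRep N) U p / N) / 2 ∂ν) := by
  have hN : (N : ℝ) ≠ 0 := Nat.cast_ne_zero.2 (NeZero.ne N)
  have hint : ∀ (ρ' : Measure (GaugeConfig d L (Matrix.specialUnitaryGroup (Fin N) ℂ))) [IsProbabilityMeasure ρ'],
      Integrable (fun U => WilsonRP.plaqRe (suRep N) U p) ρ' := fun ρ' _ =>
    (integrable_const (N : ℝ)).mono' (WilsonRP.measurable_plaqRe (suRep N) continuous_suRep p).aestronglyMeasurable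
      (ae_of_all _ fun U => by rw [Real.norm_eq_abs]; exact WilsonRP.abs_plaqRe_le (suRep N) continuous_suRep U p)
  have hsplit : ∀ (ρ' : Measure (GaugeConfig d L (Matrix.specialUnitaryGroup (Fin N) ℂ))) [IsProbabilityMeasure ρ'],
      ∫ U, (1 + WilsonRP.plaqRe (suRep N) U p / N) / 2 ∂ρ' = (1 + (∫ U, WilsonRP.plaqRe (suRep N) U p ∂ρ') / N) / 2 := by
    intro ρ' _
    have h1 : (fun U => (1 + WilsonRP.plaqRe (suRep N) U p / N) / 2) =
        fun U => (1 / 2 : ℝ) + (1 / (2 * N)) * WilsonRP.plaqRe (suRep N) U p := by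
      funext U; ring
    rw [h1, integral_add (integrable_const _) ((hint ρ').const_mul _), MeasureTheory.integral_const, integral_const_mul,
      probReal_univ, one_smul]
    ring
  rw [hsplit μ, hsplit ν]
  have key : ∀ a b : ℝ, 2 * N * ((1 + a / N) / 2 - (1 + b / N) / 2) = a - b := fun a b => by
    field_simp
    try ring
  exact (key _ _).symm

/-- **THE TWO ARMS' PLAQUETTE EXPECTATIONS APPROACH EACH OTHER AT EXPLICIT GEOMETRIC RATES**: with the `k`, `δ`, `ε'` of
`twoArms_integral_sub_le`, for every plaquette `p`, all probability starts and all steps `t`, `t'`: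
`|E^{HMC}_t[Re tr U_p] − E^{E1}_{t'}[Re tr U_p]| ≤ 2N((1 − δ)^{⌊t/(k+1)⌋} + (1 − ε')^{t'})`. -/
theorem twoArms_plaqRe_sub_le (L : ℕ) [NeZero L] (hL : 2 ≤ L) {nstep : ℕ} {ε : ℝ} (hn : 1 ≤ nstep) (hε : 0 < ε)
    (hτ : nstep * ε ≤ sunWilsonTrajThreshold N d β) (frames : List (Fin N ≃ Fin 2 ⊕ m))
    (hlex : frames.map pairOf = lexPairs (Finset.univ.sort (· ≤ ·) : List (Fin N)) ∨
      frames.map pairOf = (lexPairs (Finset.univ.sort (· ≤ ·) : List (Fin N))).reverse)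
    {links : List (Edge d L)} (hl : ∀ l, l ∈ links) (sched : List (Edge d L × (Fin N ≃ Fin 2 ⊕ m))) :
    ∃ k : ℕ, ∃ δ : ℝ, ∃ ε' : ℝ, 0 < δ ∧ δ ≤ 1 ∧ 0 < ε' ∧
      ∀ (μ₀ μ₀' : Measure (GaugeConfig d L (Matrix.specialUnitaryGroup (Fin N) ℂ))) [IsProbabilityMeasure μ₀]
        [IsProbabilityMeasure μ₀'] (t t' : ℕ) (p : Plaquette d L),
        |∫ U, WilsonRP.plaqRe (suRep N) U p ∂((fun ν : Measure (GaugeConfig d L (Matrix.specialUnitaryGroup (Fin N) ℂ)) =>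
              ν.bind (sunLeapfrogHMCN (sunCoordι N) (sunCoordι_skew N) ε (Measure.addHaar : Measure (SUNCoords N))
                (sunKinetic N) (measurable_halfKick_sun N (measurable_sunWilsonForce N (d := d) (L := L) β) ε)
                (fun U => β * wilsonAction (suRep N) U) nstep))^[t] μ₀)
          - ∫ U, WilsonRP.plaqRe (suRep N) U p ∂((fun ν : Measure (GaugeConfig d L (Matrix.specialUnitaryGroup (Fin N) ℂ)) =>
              ν.bind (cmORSweep sched ∘ₖ latSweep (gibbsDensity fun U => β * wilsonAction (suRep N) U) frames links))^[t'] μ₀')|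
          ≤ 2 * N * ((1 - δ) ^ (t / (k + 1)) + (1 - ε') ^ t') := by
  obtain ⟨k, δ, ε', hδ, hδ1, hε', h⟩ := twoArms_integral_sub_le N d β L hL hn hε hτ frames hlex hl sched
  refine ⟨k, δ, ε', hδ, hδ1, hε', fun μ₀ μ₀' _ _ t t' p => ?_⟩
  have hN0 : (0 : ℝ) < N := Nat.cast_pos.2 (Nat.pos_of_ne_zero (NeZero.ne N))
  have h0 : ∀ U : GaugeConfig d L (Matrix.specialUnitaryGroup (Fin N) ℂ), 0 ≤ (1 + WilsonRP.plaqRe (suRep N) U p / N) / 2 := by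
    intro U
    have hb := WilsonRP.abs_plaqRe_le (suRep N) continuous_suRep U p
    have : -1 ≤ WilsonRP.plaqRe (suRep N) U p / N := by
      rw [le_div_iff₀ hN0]; linarith [neg_abs_le (WilsonRP.plaqRe (suRep N) U p)]
    linarith
  have h1 : ∀ U : GaugeConfig d L (Matrix.specialUnitaryGroup (Fin N) ℂ), (1 + WilsonRP.plaqRe (suRep N) U p / N) / 2 ≤ 1 := by
    intro U
    have hb := WilsonRP.abs_plaqRe_le (suRep N) continuous_suRep U p
    have : WilsonRP.plaqRe (suRep N) U p / N ≤ 1 := by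
      rw [div_le_iff₀ hN0]; linarith [le_abs_self (WilsonRP.plaqRe (suRep N) U p)]
    linarith
  have hg : Measurable fun U : GaugeConfig d L (Matrix.specialUnitaryGroup (Fin N) ℂ) => (1 + WilsonRP.plaqRe (suRep N) U p / N) / 2 :=
    ((WilsonRP.measurable_plaqRe (suRep N) continuous_suRep p).div_const _ |>.const_add _).div_const _
  have hb := h μ₀ μ₀' t t' hg h0 h1
  haveI : IsMarkovKernel (sunLeapfrogHMCN (sunCoordι N) (sunCoordι_skew N) ε (Measure.addHaar : Measure (SUNCoords N))
      (sunKinetic N) (measurable_halfKick_sun N (measurable_sunWilsonForce N (d := d) (L := L) β) ε)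
      (fun U => β * wilsonAction (suRep N) U) nstep) := by
    haveI : Fact (Measurable fun z : GaugeConfig d L (Matrix.specialUnitaryGroup (Fin N) ℂ) × (Edge d L → SUNCoords N) =>
        β * wilsonAction (suRep N) z.1 + sunKinetic N z.2) :=
      ⟨((continuous_smul_wilsonAction (suRep N) continuous_suRep β).measurable.comp measurable_fst).add
        ((measurable_sunKinetic N).comp measurable_snd)⟩
    haveI := isProbabilityMeasure_sunMomentumLaw (L := Edge d L) (Measure.addHaar : Measure (SUNCoords N)) (sunKinetic N)
      (measurable_sunKinetic N) (sunMomentumWeight_sunKinetic_ne_top N Measure.addHaar)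
    unfold sunLeapfrogHMCN; infer_instance
  haveI := isMarkovKernel_cmHeatBath_orSweep N d β L frames links sched
  haveI := isProbabilityMeasure_iterate_bind (κ := sunLeapfrogHMCN (sunCoordι N) (sunCoordι_skew N) ε
    (Measure.addHaar : Measure (SUNCoords N)) (sunKinetic N)
    (measurable_halfKick_sun N (measurable_sunWilsonForce N (d := d) (L := L) β) ε) (fun U => β * wilsonAction (suRep N) U) nstep) μ₀ t
  haveI := isProbabilityMeasure_iterate_bind
    (κ := cmORSweep sched ∘ₖ latSweep (gibbsDensity fun U => β * wilsonAction (suRep N) U) frames links) μ₀' t'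
  rw [integral_plaqRe_sub_eq, abs_mul, abs_of_pos (by positivity : (0 : ℝ) < 2 * N)]
  exact mul_le_mul_of_nonneg_left hb (by positivity)

end Arms

end Summit.Ventures.LatticeQCDFlow.Exactness
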